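import Summits.ResolutionOfSingularities.ResolutionOfSingularities.Theorems.FrobeniusClosingSteerToricUnitExitKRel
import Summits.ResolutionOfSingularities.ResolutionOfSingularities.Theorems.FrobeniusClosingSteerToricUnitExitTarget
import Summits.ResolutionOfSingularities.ResolutionOfSingularities.Theorems.FrobeniusClosingSteerToricUnitExitDual

/-!
# Crux `Steer` (stmt-ResolutionOfSingularities-16345) — K-TX part 4d, the TRANSPORTED FRAME: the toric state `(R, z)` enriched with the
# residue-compatible map `Φ`, the exponent rows `k_j^±`, constants `γ_j`, dual weights `c_j` and a freshness bound; the step relation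
# `PRel`; reflexivity, transitivity, and the TRIVIAL (unit-pivot) step

OURS (design: seat folder `D/res-D-brk-2/HANDOFF.md`, gen 6, "4d route REFINED"); [cite: NovacoskiSpivakovsky2014, Def. 2.11].

A `TState` is `(R, z, Φ, k⁺, k⁻, γ, c, B)`.  It is GOOD (`Good O R₀ s`) when `(R, z)` is a frame (`…ToricUnitExitFrame.Frame`), `Φ : R → L`
is residue-compatible (`…Target.ResCompat`), sends the base ring `R₀` to constants, kills the non-unit letters, sends every unit letter `z_j`
to `γ_j · Y^{k_j⁺} / Y^{k_j⁻}` (`γ_j ≠ 0`, variables `(u, i)` with `u` a unit of `O` and `i < B`), the weights vanish from index `B` on,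
and `(k_j⁺ − k_j⁻, c_j)_{j unit}` are dual rows (`…Dual.DualRows`).  `PRel O R₀ s s' T` is `KRel` on the underlying frames plus `R ≤ R'`,
goodness of `s'` and `Φ' extends Φ`.  This file: the definitions, `prel_refl`, `prel_trans`, `prel_good` and the projections the generic
Perron induction (`…SteerGenericPerron`) consumes, and the unit-pivot step `prel_step_unit` (ring and `Φ` unchanged; rows divided,
weights dually updated — `DualRows.div_step`).  The genuine step (chart descent of `Φ`, tie-births — `DualRows.birth`) is the next file.
-/

noncomputable section

-- single-problem summit: the doubled namespace component `ResolutionOfSingularities` is forced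
set_option linter.dupNamespace false

open scoped BigOperators

namespace Summit.ResolutionOfSingularities.ResolutionOfSingularities.Theorems.SteerToricUnitExit

open IsLocalRing MvPolynomial
open Literature.AlgebraicGeometry.Resolution
open Summit.ResolutionOfSingularities.ResolutionOfSingularities.Theorems.SwitchingDichotomy
open Summit.ResolutionOfSingularities.ResolutionOfSingularities.Theorems.SteerToricVertexSplit

variable {K : Type} [Field K]

section Defs

/-- The integer row `k⁺ − k⁻` of a pair of natural-number exponent vectors. [folklore] -/
def rowZ {ι : Type} (kp km : ι →₀ ℕ) : ι →₀ ℤ :=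
  kp.mapRange (fun m : ℕ => (m : ℤ)) (by simp) - km.mapRange (fun m : ℕ => (m : ℤ)) (by simp)

/-- `rowZ` is additive in the pair: `rowZ (k⁺ + l⁻) (k⁻ + l⁺) = rowZ k⁺ k⁻ − rowZ l⁺ l⁻`. [folklore] -/
theorem rowZ_div {ι : Type} (kp km lp lm : ι →₀ ℕ) : rowZ (kp + lm) (km + lp) = rowZ kp km - rowZ lp lm := by
  unfold rowZ
  rw [Finsupp.mapRange_add (fun _ _ => by push_cast; rfl), Finsupp.mapRange_add (fun _ _ => by push_cast; rfl)]
  abel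

/-- `rowZ (single v 1) 0 = single v 1`. [folklore] -/
theorem rowZ_single {ι : Type} (v : ι) : rowZ (Finsupp.single v 1) 0 = Finsupp.single v (1 : ℤ) := by
  unfold rowZ; simp

/-- A coordinate of `rowZ` vanishes where both parts do. [folklore] -/
theorem rowZ_apply_eq_zero {ι : Type} (kp km : ι →₀ ℕ) (v : ι) (hp : kp v = 0) (hm : km v = 0) : rowZ kp km v = 0 := by
  unfold rowZ; simp [hp, hm]

variable (O : ValuationSubring K) [(kerRes O).IsPrime] (n : ℕ)

/-- **Transported toric state** `(R, z, Φ, k⁺, k⁻, γ, c, B)`. OURS bookkeeping. [folklore] -/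
structure TState where
  /-- the current local ring -/
  R : Subring K
  /-- the current letters -/
  z : Fin n → K
  /-- the transport map to `L = κ(O)[Y]_𝔭` -/
  Φ : R →+* Localization.AtPrime (kerRes O)
  /-- positive parts of the exponent rows of the unit letters -/
  kp : Fin n → (K × ℕ →₀ ℕ)
  /-- negative parts -/
  km : Fin n → (K × ℕ →₀ ℕ)
  /-- the constants -/
  γ : Fin n → ResidueField O
  /-- the dual weights -/
  c : Fin n → K × ℕ → ResidueField O
  /-- freshness bound: every variable in use has index `< B` -/
  B : ℕ

variable {O n}

/-- The `Φ`-part of goodness (see the module docstring). OURS bookkeeping. [folklore] -/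
def GoodPhi (R₀ : Subring K) (s : TState O n) : Prop :=
  ∃ hRO : s.R ≤ O.toSubring, R₀ ≤ s.R ∧ ResCompat O s.R hRO s.Φ ∧
    (∀ r : s.R, (r : K) ∈ R₀ →
      s.Φ r = algebraMap (MvPolynomial (K × ℕ) (ResidueField O)) (Localization.AtPrime (kerRes O)) (C (resK O r))) ∧
    (∀ (j : Fin n) (r : s.R), (r : K) = s.z j → O.valuation (s.z j) < 1 → s.Φ r = 0) ∧
    (∀ (j : Fin n) (r : s.R), (r : K) = s.z j → O.valuation (s.z j) = 1 → s.γ j ≠ 0 ∧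
      algebraMap (MvPolynomial (K × ℕ) (ResidueField O)) (Localization.AtPrime (kerRes O)) (monomial (s.km j) 1) * s.Φ r =
        algebraMap (MvPolynomial (K × ℕ) (ResidueField O)) (Localization.AtPrime (kerRes O))
          (C (s.γ j) * monomial (s.kp j) 1)) ∧
    (∀ (j : Fin n) (v : K × ℕ), v ∈ (s.kp j + s.km j).support → O.valuation v.1 = 1 ∧ v.2 < s.B) ∧
    (∀ (j : Fin n) (v : K × ℕ), s.B ≤ v.2 → s.c j v = 0) ∧
    DualRows {j : Fin n | O.valuation (s.z j) = 1} (fun j => rowZ (s.kp j) (s.km j)) s.c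

/-- **Goodness**: a frame with good transport data. OURS bookkeeping. [folklore] -/
def Good (R₀ : Subring K) (s : TState O n) : Prop :=
  Frame O s.R s.z ∧ GoodPhi R₀ s

/-- **The transported step relation**: `KRel` on the frames, `R ≤ R'`, goodness of the target, `Φ'` extends `Φ`. OURS. [folklore] -/
def PRel (R₀ : Subring K) (s s' : TState O n) (T : (Fin n → ℤ) → (Fin n → ℤ)) : Prop :=
  KRel O s.R s.z s'.R s'.z T ∧ s.R ≤ s'.R ∧ GoodPhi R₀ s' ∧ ∀ (r : s.R) (r' : s'.R), (r : K) = r' → s'.Φ r' = s.Φ r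

end Defs

section Basic

variable {O : ValuationSubring K} [(kerRes O).IsPrime] {n : ℕ} {R₀ : Subring K}

/-- Reflexivity on good states. [folklore] -/
theorem prel_refl (s : TState O n) (hs : Good R₀ s) : PRel R₀ s s id :=
  ⟨krel_refl O s.R s.z hs.1, le_rfl, hs.2, fun r r' h => by rw [show r' = r from Subtype.ext h.symm]⟩

/-- Transitivity. [folklore] -/
theorem prel_trans {s s' s'' : TState O n} {T T' : (Fin n → ℤ) → (Fin n → ℤ)} (h : PRel R₀ s s' T)
    (h' : PRel R₀ s' s'' T') : PRel R₀ s s'' (T' ∘ T) :=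
  ⟨krel_trans O h.1 h'.1, h.2.1.trans h'.2.1, h'.2.2.1, fun r r'' hr =>
    (h'.2.2.2 ⟨(r : K), h.2.1 r.2⟩ r'' hr).trans (h.2.2.2 r ⟨(r : K), h.2.1 r.2⟩ rfl)⟩

/-- The target of a step is good. [folklore] -/
theorem prel_good {s s' : TState O n} {T : (Fin n → ℤ) → (Fin n → ℤ)} (h : PRel R₀ s s' T) : Good R₀ s' :=
  ⟨h.1.2.1, h.2.2.1⟩

/-- Transformers commute with negation. [folklore] -/
theorem prel_neg {s s' : TState O n} {T : (Fin n → ℤ) → (Fin n → ℤ)} (h : PRel R₀ s s' T) (f : Fin n → ℤ) :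
    T (-f) = -T f := h.1.2.2.2.1 f

/-- Transformers re-express Laurent monomials. [folklore] -/
theorem prel_mono {s s' : TState O n} {T : (Fin n → ℤ) → (Fin n → ℤ)} (h : PRel R₀ s s' T) (f : Fin n → ℤ) :
    (∏ j, s'.z j ^ T f j) = ∏ j, s.z j ^ f j := h.1.2.2.1 f

/-- Transformers preserve `ℕ`-vectors. [folklore] -/
theorem prel_nonneg {s s' : TState O n} {T : (Fin n → ℤ) → (Fin n → ℤ)} (h : PRel R₀ s s' T) (f : Fin n → ℤ)
    (hf : ∀ j, 0 ≤ f j) (j : Fin n) : 0 ≤ T f j := h.1.2.2.2.2.1 f hf j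

/-- Transformers preserve the existence of an odd coordinate. [folklore] -/
theorem prel_odd {s s' : TState O n} {T : (Fin n → ℤ) → (Fin n → ℤ)} (h : PRel R₀ s s' T) (f : Fin n → ℤ)
    (hf : ∃ j, Odd (f j)) : ∃ j, Odd (T f j) := h.1.2.2.2.2.2 f hf

/-- Letters of a good state lie in `O` and are non-zero. [folklore] -/
theorem Good.mem_O {s : TState O n} (hs : Good R₀ s) (j : Fin n) : s.z j ∈ O := hs.1.mem_O j

/-- Letters of a good state are non-zero. [folklore] -/
theorem Good.ne_zero {s : TState O n} (hs : Good R₀ s) (j : Fin n) : s.z j ≠ 0 := hs.1.ne_zero j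

end Basic

/-! ## The unit-pivot step -/

section UnitStep

variable {O : ValuationSubring K} [(kerRes O).IsPrime] {n : ℕ} {R₀ : Subring K}

/-- The localisation map `κ(O)[Y] → L` is injective. [folklore] -/
theorem algebraMap_L_injective :
    Function.Injective (algebraMap (MvPolynomial (K × ℕ) (ResidueField O)) (Localization.AtPrime (kerRes O))) :=
  IsLocalization.injective _ (Ideal.primeCompl_le_nonZeroDivisors (kerRes O))

/-- `L` is a domain. [folklore] -/
theorem isDomain_L : IsDomain (Localization.AtPrime (kerRes O)) :=
  IsLocalization.isDomain_of_le_nonZeroDivisors _ (Ideal.primeCompl_le_nonZeroDivisors (kerRes O))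

/-- A non-zero polynomial is non-zero in `L`. [folklore] -/
theorem algebraMap_L_ne_zero {p : MvPolynomial (K × ℕ) (ResidueField O)} (hp : p ≠ 0) :
    algebraMap (MvPolynomial (K × ℕ) (ResidueField O)) (Localization.AtPrime (kerRes O)) p ≠ 0 := by
  rw [Ne, ← map_zero (algebraMap (MvPolynomial (K × ℕ) (ResidueField O)) (Localization.AtPrime (kerRes O))),
    algebraMap_L_injective.eq_iff]
  exact hp

/-- **The unit-pivot step.** For a good state and letters `a ≠ b` with `z_a` a UNIT: the state with `z_b ↦ z_b / z_a` (same ring, same `Φ`;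
if `z_b` is a unit its row is divided by the row of `z_a`, the weight of `a` absorbs that of `b`, `γ_b ↦ γ_b/γ_a`) is good and related
by `PRel` with the transformer `f ↦ update f a (f a + f b)`. OURS. [folklore] -/
theorem prel_step_unit (s : TState O n) (hs : Good R₀ s) {a b : Fin n} (hab : a ≠ b) (hva : O.valuation (s.z a) = 1) :
    ∃ s' : TState O n, PRel R₀ s s' (fun f => Function.update f a (f a + f b)) := by
  classical
  haveI := isDomain_L (O := O)
  obtain ⟨hF, hRO, hR₀, hΦ, hconst, hkill, hunit, hsupp, hcB, hdual⟩ := hs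
  have hz0 := hF.ne_zero
  have hzR : ∀ j, s.z j ∈ s.R := by obtain ⟨_, _, _, _, _, hz, _⟩ := hF; exact hz
  have hva' : ¬ O.valuation (s.z a) < 1 := by rw [hva]; exact lt_irrefl _
  obtain ⟨hbl, hF'⟩ := frame_step_unit O s.R s.z hF hab hva'
  set za : s.R := ⟨s.z a, hzR a⟩ with hza
  set zb : s.R := ⟨s.z b, hzR b⟩ with hzb
  have hΦa : IsUnit (s.Φ za) := hΦ.isUnit za hva
  have hval_u : O.valuation (s.z b / s.z a) = O.valuation (s.z b) := by rw [map_div₀, hva, div_one]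
  -- `Φ r · Φ z_a = Φ z_b` whenever `r = z_b / z_a`
  have hΦu : ∀ r : s.R, (r : K) = s.z b / s.z a → s.Φ r * s.Φ za = s.Φ zb := by
    intro r hr
    rw [← map_mul]; congr 1; apply Subtype.ext
    change (r : K) * s.z a = s.z b
    rw [hr, div_mul_cancel₀ _ (hz0 a)]
  have hkrel : KRel O s.R s.z s.R (Function.update s.z b (s.z b / s.z a)) (fun f => Function.update f a (f a + f b)) :=
    ⟨hbl, hF', prod_zpow_update_shift s.z hz0 hab, shift_neg a b, fun f hf => shift_nonneg a b hf, fun f hf => shift_odd hab hf⟩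
  -- letters other than `b` do not move
  have hzj : ∀ j, j ≠ b → Function.update s.z b (s.z b / s.z a) j = s.z j := fun j hj => Function.update_of_ne hj _ _
  by_cases hvb : O.valuation (s.z b) = 1
  · -- `z_b` a unit: divide rows, update weights dually
    obtain ⟨hγa, ha⟩ := hunit a za rfl hva
    obtain ⟨hγb, hb⟩ := hunit b zb rfl hvb
    have hU : {j : Fin n | O.valuation (Function.update s.z b (s.z b / s.z a) j) = 1} = {j | O.valuation (s.z j) = 1} := by
      ext j; by_cases hjb : j = b
      · subst hjb; simp [hval_u, hvb]
      · simp [hzj j hjb]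
    have hgood' : GoodPhi R₀ (⟨s.R, Function.update s.z b (s.z b / s.z a), s.Φ, Function.update s.kp b (s.kp b + s.km a),
        Function.update s.km b (s.km b + s.kp a), Function.update s.γ b (s.γ b / s.γ a), Function.update s.c a (s.c a + s.c b),
        s.B⟩ : TState O n) := by
      refine ⟨hRO, hR₀, hΦ, hconst, fun j r hr hvj => ?_, fun j r hr hvj => ?_, fun j v hv => ?_, fun j v hv => ?_, ?_⟩ <;>
        dsimp only at *
      · -- non-unit letters are old letters `j ≠ b`
        have hjb : j ≠ b := by rintro rfl; rw [Function.update_self, hval_u, hvb] at hvj; exact lt_irrefl _ hvj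
        rw [hzj j hjb] at hr hvj
        exact hkill j r hr hvj
      · by_cases hjb : j = b
        · subst hjb
          rw [Function.update_self] at hr
          rw [Function.update_self, Function.update_self, Function.update_self]
          refine ⟨div_ne_zero hγb hγa, ?_⟩
          have m1 : (monomial (s.km j + s.kp a) (1 : ResidueField O)) = monomial (s.km j) 1 * monomial (s.kp a) 1 := by
            rw [monomial_mul, mul_one]
          have m2 : (monomial (s.kp j + s.km a) (1 : ResidueField O)) = monomial (s.kp j) 1 * monomial (s.km a) 1 := by
            rw [monomial_mul, mul_one]
          have hC : (C (s.γ j / s.γ a) : MvPolynomial (K × ℕ) (ResidueField O)) * C (s.γ a) = C (s.γ j) := by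
            rw [← map_mul, div_mul_cancel₀ _ hγa]
          -- `Y^{k_b⁻ + k_a⁺} Φr · (Y^{k_a⁻} Φz_a) = (γ_b/γ_a) Y^{k_b⁺ + k_a⁻} · (γ_a Y^{k_a⁺})`, then cancel the right factor
          have key : algebraMap (MvPolynomial (K × ℕ) (ResidueField O)) (Localization.AtPrime (kerRes O))
                (monomial (s.km j + s.kp a) 1) * s.Φ r *
                (algebraMap (MvPolynomial (K × ℕ) (ResidueField O)) (Localization.AtPrime (kerRes O)) (monomial (s.km a) 1) *
                  s.Φ za) =
              algebraMap (MvPolynomial (K × ℕ) (ResidueField O)) (Localization.AtPrime (kerRes O))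
                (C (s.γ j / s.γ a) * monomial (s.kp j + s.km a) 1) *
                algebraMap (MvPolynomial (K × ℕ) (ResidueField O)) (Localization.AtPrime (kerRes O))
                  (C (s.γ a) * monomial (s.kp a) 1) := by
            calc _ = algebraMap (MvPolynomial (K × ℕ) (ResidueField O)) (Localization.AtPrime (kerRes O))
                    (monomial (s.kp a) (1 : ResidueField O)) *
                  (algebraMap (MvPolynomial (K × ℕ) (ResidueField O)) (Localization.AtPrime (kerRes O))
                    (monomial (s.km j) (1 : ResidueField O)) * (s.Φ r * s.Φ za) *
                  (algebraMap (MvPolynomial (K × ℕ) (ResidueField O)) (Localization.AtPrime (kerRes O))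
                    (monomial (s.km a) (1 : ResidueField O)))) := by rw [m1, map_mul]; ring
              _ = algebraMap (MvPolynomial (K × ℕ) (ResidueField O)) (Localization.AtPrime (kerRes O))
                    (monomial (s.kp a) (1 : ResidueField O)) *
                  (algebraMap (MvPolynomial (K × ℕ) (ResidueField O)) (Localization.AtPrime (kerRes O))
                    (C (s.γ j) * monomial (s.kp j) (1 : ResidueField O)) *
                  (algebraMap (MvPolynomial (K × ℕ) (ResidueField O)) (Localization.AtPrime (kerRes O))
                    (monomial (s.km a) (1 : ResidueField O)))) := by rw [hΦu r hr, hb]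
              _ = algebraMap (MvPolynomial (K × ℕ) (ResidueField O)) (Localization.AtPrime (kerRes O))
                    (monomial (s.kp a) 1 * (C (s.γ j / s.γ a) * C (s.γ a) * monomial (s.kp j) 1) * monomial (s.km a) 1) := by
                rw [hC]; simp only [map_mul]; ring
              _ = _ := by rw [m2]; simp only [map_mul]; ring
          rw [ha] at key
          have hne : algebraMap (MvPolynomial (K × ℕ) (ResidueField O)) (Localization.AtPrime (kerRes O))
              (C (s.γ a) * monomial (s.kp a) 1) ≠ 0 :=
            algebraMap_L_ne_zero (mul_ne_zero ((map_ne_zero C).mpr hγa) (monomial_eq_zero.not.mpr one_ne_zero))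
          exact mul_right_cancel₀ hne key
        · rw [Function.update_of_ne hjb, Function.update_of_ne hjb, Function.update_of_ne hjb]
          rw [hzj j hjb] at hr hvj
          exact hunit j r hr hvj
      · -- supports
        by_cases hjb : j = b
        · subst hjb
          rw [Function.update_self, Function.update_self] at hv
          have hv' : v ∈ (s.kp j + s.km j).support ∨ v ∈ (s.kp a + s.km a).support := by
            simp only [Finsupp.mem_support_iff, Finsupp.add_apply] at hv ⊢; omega
          exact hv'.elim (hsupp j v) (hsupp a v)
        · rw [Function.update_of_ne hjb, Function.update_of_ne hjb] at hv; exact hsupp j v hv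
      · -- weights vanish from `B` on
        by_cases hja : j = a
        · subst hja; rw [Function.update_self, Pi.add_apply, hcB j v hv, hcB b v hv, add_zero]
        · rw [Function.update_of_ne hja]; exact hcB j v hv
      · -- dual rows: the division step
        rw [hU]
        have hrows : (fun j => rowZ (Function.update s.kp b (s.kp b + s.km a) j) (Function.update s.km b (s.km b + s.kp a) j)) =
            Function.update (fun j => rowZ (s.kp j) (s.km j)) b (rowZ (s.kp b) (s.km b) - rowZ (s.kp a) (s.km a)) := by
          funext j
          by_cases hjb : j = b
          · subst hjb; simp only [Function.update_self, rowZ_div]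
          · simp only [Function.update_of_ne hjb]
        rw [hrows]
        exact hdual.div_step hva hvb hab
    exact ⟨⟨s.R, Function.update s.z b (s.z b / s.z a), s.Φ, Function.update s.kp b (s.kp b + s.km a),
        Function.update s.km b (s.km b + s.kp a), Function.update s.γ b (s.γ b / s.γ a), Function.update s.c a (s.c a + s.c b),
        s.B⟩, hkrel, le_rfl, hgood', fun r r' h => by rw [show r' = r from Subtype.ext h.symm]⟩
  · -- `z_b` a non-unit: nothing but the letter changes
    have hvb' : O.valuation (s.z b) < 1 := lt_of_le_of_ne ((O.valuation_le_one_iff _).mpr (hRO (hzR b))) hvb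
    have hU : {j : Fin n | O.valuation (Function.update s.z b (s.z b / s.z a) j) = 1} = {j | O.valuation (s.z j) = 1} := by
      ext j; by_cases hjb : j = b
      · subst hjb; simp [hval_u, hvb]
      · simp [hzj j hjb]
    have hgood' : GoodPhi R₀ (⟨s.R, Function.update s.z b (s.z b / s.z a), s.Φ, s.kp, s.km, s.γ, s.c, s.B⟩ : TState O n) := by
      refine ⟨hRO, hR₀, hΦ, hconst, fun j r hr hvj => ?_, fun j r hr hvj => ?_, hsupp, hcB, ?_⟩ <;> dsimp only at *
      · by_cases hjb : j = b
        · subst hjb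
          rw [Function.update_self] at hr
          -- `Φ r · Φ z_a = Φ z_b = 0` with `Φ z_a` a unit
          have h0 : s.Φ r * s.Φ za = 0 := by rw [hΦu r hr]; exact hkill j zb rfl hvb'
          exact (hΦa.mul_left_eq_zero).mp h0
        · rw [hzj j hjb] at hr hvj; exact hkill j r hr hvj
      · have hjb : j ≠ b := by rintro rfl; rw [Function.update_self, hval_u] at hvj; exact hvb hvj
        rw [hzj j hjb] at hr hvj
        exact hunit j r hr hvj
      · rw [hU]; exact hdual
    exact ⟨⟨s.R, Function.update s.z b (s.z b / s.z a), s.Φ, s.kp, s.km, s.γ, s.c, s.B⟩, hkrel, le_rfl, hgood',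
      fun r r' h => by rw [show r' = r from Subtype.ext h.symm]⟩

end UnitStep

end Summit.ResolutionOfSingularities.ResolutionOfSingularities.Theorems.SteerToricUnitExit

end
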